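import Literature.NumberTheory.LFunctions.RayClassPartialZetaGrowth
import HarnessLib

/-!
# Hecke `L`-series of non-principal ray class characters are entire of finite order

Topic `Literature/NumberTheory/LFunctions`; namespace `Literature.NumberTheory.LFunctions`.  Pure-proof
companion of `RayClassPartialZetaResidue.lean` / `RayClassOrthogonality.lean` (Hecke 1917: `L(χ, s)` is entire
for a non-principal ray class character `χ mod 𝔪`, Neukirch VII (8.5)–(8.6) with Remark 1 and §5 p. 473) and
of `RayClassPartialZetaGrowth.lean`.  Everything here is PROVED; no definition and no named fact is introduced.

* `exists_rayClassPartialZeta_eq_add_div_growth` — Neukirch VII (5.11) for the narrow ray classes `mod 𝔪`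
  WITH GROWTH: one `ρ = ρ_𝔪` and, for every nonzero integral `𝔟` prime to `𝔪`, an entire `Z₀^𝔟` with
  `Z_𝔪(𝔟, s) = Z₀^𝔟(s) + ρ/(s−1)` on `Re(s) > 1` and `‖Z₀^𝔟(s)‖ ≤ A_R exp(c_R‖s‖²)` on every strip `|Re s| ≤ R`;
* `exists_differentiable_eq_rayClassLSeries_growth` — **for a non-principal ray class character `χ mod 𝔪`
  the `L`-series `L(χ, s)` extends to an ENTIRE FUNCTION OF FINITE ORDER**: an entire `L` with
  `L(s) = L(χ, s)` on `Re(s) > 1` and `‖L(s)‖ ≤ A_R exp(c_R ‖s‖²)` on every vertical strip `|Re s| ≤ R`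
  (Hecke; the growth is the standard consequence of the integral representation, Neukirch VII (1.4) proof,
  and is the a-priori input of the Phragmén–Lindelöf convexity bounds for Hecke `L`-functions, Rademacher
  1959 §5).

## References

* J. Neukirch, *Algebraic Number Theory*, Grundlehren 322, Springer 1999, Ch. VII §1 (1.4), §5 (5.11) and
  p. 473, §8 (8.5)–(8.6) with Remark 1. [NeukirchANT1999]
* E. Hecke, *Über eine neue Anwendung der Zetafunktionen auf die Arithmetik der Zahlkörper*, Nachr. Ges.
  Wiss. Göttingen (1917), 90–95. [Hecke1917]
* H. Rademacher, *On the Phragmén–Lindelöf theorem and some applications*, Math. Z. 72 (1959), 192–204, §5.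
  [Rademacher1959]
-/

noncomputable section

open Complex NumberField NumberField.InfinitePlace NumberField.Units IsDedekindDomain Filter Topology Set Metric
open scoped NumberField nonZeroDivisors
open scoped Classical

namespace Literature.NumberTheory.LFunctions

variable {K : Type*} [Field K] [NumberField K]

/-! ### Divided differences keep the growth (private copy of the helper of `RayClassPartialZetaGrowth`) -/

omit [NumberField K] in
/-- **Divided differences of an entire function of growth `exp(O(‖s‖²))` on a strip have the same growth
there**: inside the unit disc around `a` the entire function `dslope G a` is bounded, outside
`‖(G(s) − G(a))/(s − a)‖ ≤ ‖G(s)‖ + ‖G(a)‖`. [folklore] -/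
private theorem growth_dslope' {G : ℂ → ℂ} (hG : Differentiable ℂ G) (a : ℂ) {R : ℝ}
    (hgr : ∃ A c : ℝ, 0 ≤ A ∧ 0 ≤ c ∧ ∀ s ∈ {s : ℂ | |s.re| ≤ R}, ‖G s‖ ≤ A * Real.exp (c * ‖s‖ ^ 2)) :
    ∃ A c : ℝ, 0 ≤ A ∧ 0 ≤ c ∧ ∀ s ∈ {s : ℂ | |s.re| ≤ R},
      ‖dslope G a s‖ ≤ A * Real.exp (c * ‖s‖ ^ 2) := by
  obtain ⟨A, c, hA, hc, h⟩ := hgr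
  -- the entire function `dslope G a` is bounded on the closed unit disc around `a`
  have hd : Differentiable ℂ (dslope G a) :=
    differentiableOn_univ.mp ((Complex.differentiableOn_dslope Filter.univ_mem).mpr hG.differentiableOn)
  obtain ⟨M, hM⟩ := (isCompact_closedBall a 1).exists_bound_of_continuousOn hd.continuous.continuousOn
  have hM0 : 0 ≤ M := le_trans (norm_nonneg _) (hM a (mem_closedBall_self zero_le_one))
  refine ⟨A + ‖G a‖ + M, c, by positivity, hc, fun s hs ↦ ?_⟩
  have he1 : 1 ≤ Real.exp (c * ‖s‖ ^ 2) := Real.one_le_exp (by positivity)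
  by_cases hsa : dist s a ≤ 1
  · calc ‖dslope G a s‖ ≤ M := hM s (mem_closedBall.mpr hsa)
      _ ≤ (A + ‖G a‖ + M) * 1 := by nlinarith [norm_nonneg (G a)]
      _ ≤ (A + ‖G a‖ + M) * Real.exp (c * ‖s‖ ^ 2) :=
          mul_le_mul_of_nonneg_left he1 (by positivity)
  · push Not at hsa
    have hne : s ≠ a := fun h' ↦ by rw [h', dist_self] at hsa; linarith
    have hsa' : 1 ≤ ‖s - a‖ := by rw [← dist_eq_norm]; exact hsa.le
    rw [dslope_of_ne _ hne, slope_def_field, norm_div]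
    calc ‖G s - G a‖ / ‖s - a‖ ≤ ‖G s - G a‖ / 1 :=
          div_le_div_of_nonneg_left (norm_nonneg _) one_pos hsa'
      _ ≤ ‖G s‖ + ‖G a‖ := by rw [div_one]; exact norm_sub_le _ _
      _ ≤ A * Real.exp (c * ‖s‖ ^ 2) + ‖G a‖ * Real.exp (c * ‖s‖ ^ 2) := by
          have := h s hs
          nlinarith [norm_nonneg (G a)]
      _ ≤ (A + ‖G a‖ + M) * Real.exp (c * ‖s‖ ^ 2) := by nlinarith [Real.exp_pos (c * ‖s‖ ^ 2)]

/-! ### Neukirch VII (5.11) for narrow ray classes, with growth -/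

/-- **The partial zeta functions of the narrow ray classes `mod 𝔪`: entire part of finite order and common
residue** (`exists_rayClassPartialZeta_eq_add_div` with growth).  For `𝔪 ≠ 0` there is `ρ ∈ ℂ` such that for
every nonzero integral `𝔟` prime to `𝔪` there is an entire `Z₀` with `Z_𝔪(𝔟, s) = Z₀(s) + ρ/(s-1)` for
`Re(s) > 1` and `‖Z₀(s)‖ ≤ A_R exp(c_R ‖s‖²)` on every strip `|Re s| ≤ R`:
`Z₀ = C·E + ρ'·dslope(C, 1)` with `C(s) = h⁻¹ 2^{-r₁} 𝔑(𝔟)^{-s}` (bounded on strips) and `E` the entire part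
of `Σ_p D_p` (`NumberField.exists_entire_sum_signedCosetSum_eq_add_div_growth`).
[cite: NeukirchANT1999, Ch. VII §5 Cor. (5.11) and §8 Thm. (8.5) with Remark 1 (after (8.6))] -/
theorem exists_rayClassPartialZeta_eq_add_div_growth {𝔪 : Ideal (𝓞 K)} (h𝔪 : 𝔪 ≠ ⊥) :
    ∃ ρ : ℂ, ∀ 𝔟 : Ideal (𝓞 K), 𝔟 ≠ ⊥ → IsCoprime 𝔟 𝔪 →
      ∃ Z₀ : ℂ → ℂ, Differentiable ℂ Z₀ ∧
        (∀ R : ℝ, 0 ≤ R → ∃ A c : ℝ, 0 ≤ A ∧ 0 ≤ c ∧ ∀ s ∈ {s : ℂ | |s.re| ≤ R},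
          ‖Z₀ s‖ ≤ A * Real.exp (c * ‖s‖ ^ 2)) ∧
        ∀ s : ℂ, 1 < s.re → rayClassPartialZeta 𝔪 𝔟 s = Z₀ s + ρ / (s - 1) := by
  obtain ⟨N, hN0, hN, hNu⟩ := exists_even_pow_sub_one_mem (K := K) h𝔪
  have hNm : ∀ i, ((fundSystem K i : (𝓞 K)ˣ) : 𝓞 K) ^ N - 1 ∈ 𝔪 := fun i ↦ hNu _
  -- the `𝔟`-independent multiplicity
  set h₀ : ℕ := Nat.card {x : K // (∃ u : (𝓞 K)ˣ, u ∈ narrowRayUnits 𝔪 ∧ ((u : 𝓞 K) : K) = x) ∧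
    InConeBox N x} with hh₀
  refine ⟨((h₀ : ℂ))⁻¹ * ((2 : ℂ) ^ Fintype.card {w : InfinitePlace K // IsReal w})⁻¹ *
      (2 * ((((Ideal.absNorm 𝔪 : ℝ) * Real.sqrt |(discr K : ℝ)|)⁻¹ : ℝ) : ℂ) *
        ((((NumberField.pieceCst K N : ℝ) : ℂ))⁻¹ * (NumberField.gammaFactorCP K ∅ (1 / 2))⁻¹)),
    fun 𝔟 h𝔟 hcop ↦ ?_⟩
  -- the coset `1 + 𝔪𝔟⁻¹`
  set I : (FractionalIdeal (𝓞 K)⁰ K)ˣ := Units.mk0 (rayModulus K 𝔪 𝔟) (rayModulus_ne_zero h𝔪 h𝔟) with hI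
  have hIc : (I : FractionalIdeal (𝓞 K)⁰ K) = rayModulus K 𝔪 𝔟 := rfl
  have hV : ∀ i, (((fundSystem K i : (𝓞 K)ˣ) : K) ^ N - 1) * 1 ∈ (I : FractionalIdeal (𝓞 K)⁰ K) := by
    intro i
    rw [mul_one, hIc]
    have := coeIdeal_le_rayModulus 𝔪 h𝔟 (FractionalIdeal.mem_coeIdeal_of_mem (𝓞 K)⁰ (hNm i))
    rwa [map_sub, map_pow, map_one] at this
  obtain ⟨E, hEd, hEg, hEs⟩ := NumberField.exists_entire_sum_signedCosetSum_eq_add_div_growth I 1 hN0 hN hV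
  set R : ℂ := 2 * (NumberField.heckePairW K ∅ I 1 N).ε *
    ((((NumberField.pieceCst K N : ℝ) : ℂ))⁻¹ * (NumberField.gammaFactorCP K ∅ (1 / 2))⁻¹) with hR
  -- the factor `C(s) = h⁻¹ 2^{-r₁} 𝔑(𝔟)^{-s}`
  have hNbpos : (0 : ℝ) < Ideal.absNorm 𝔟 := by
    exact_mod_cast Nat.pos_of_ne_zero (by rwa [ne_eq, Ideal.absNorm_eq_zero_iff])
  have hNb : ((Ideal.absNorm 𝔟 : ℕ) : ℂ) ≠ 0 := by exact_mod_cast hNbpos.ne'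
  set C : ℂ → ℂ := fun s ↦ ((rayMult h𝔟 hcop N : ℂ))⁻¹ *
    ((2 : ℂ) ^ Fintype.card {w : InfinitePlace K // IsReal w})⁻¹ * ((Ideal.absNorm 𝔟 : ℕ) : ℂ) ^ (-s) with hC
  have hCd : Differentiable ℂ C := by
    rw [hC]
    exact (differentiable_const _).mul (differentiable_id.neg.const_cpow (Or.inl hNb))
  have hCg : ∀ R' : ℝ, 0 ≤ R' → ∃ A c : ℝ, 0 ≤ A ∧ 0 ≤ c ∧ ∀ s ∈ {s : ℂ | |s.re| ≤ R'},
      ‖C s‖ ≤ A * Real.exp (c * ‖s‖ ^ 2) := by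
    intro R' _
    have key := NumberField.growth_mul
      (NumberField.growth_const {s : ℂ | |s.re| ≤ R'} (((rayMult h𝔟 hcop N : ℂ))⁻¹ *
        ((2 : ℂ) ^ Fintype.card {w : InfinitePlace K // IsReal w})⁻¹))
      (NumberField.growth_cpow_const_mul (b := (Ideal.absNorm 𝔟 : ℝ)) hNbpos (-1) (by simp) (R := R'))
    refine NumberField.growth_of_le (fun s _ ↦ le_of_eq ?_) key
    show ‖C s‖ = _
    rw [hC]
    simp only [Pi.mul_apply, neg_one_mul, Complex.ofReal_natCast]
  refine ⟨fun s ↦ C s * E s + R * dslope C 1 s,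
    (hCd.mul hEd).add ((differentiable_const _).mul
      (differentiableOn_univ.mp ((Complex.differentiableOn_dslope Filter.univ_mem).mpr hCd.differentiableOn))),
    fun R' hR' ↦ ?_, fun s hs ↦ ?_⟩
  · have key := NumberField.growth_add (NumberField.growth_mul (hCg R' hR') (hEg R' hR'))
      (NumberField.growth_mul (NumberField.growth_const {s : ℂ | |s.re| ≤ R'} R)
        (growth_dslope' hCd 1 (hCg R' hR')))
    refine NumberField.growth_of_le (fun s _ ↦ le_of_eq ?_) key
    simp only [Pi.add_apply, Pi.mul_apply]
  have hs1 : s ≠ 1 := fun h ↦ by rw [h, Complex.one_re] at hs; linarith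
  have hs1' : s - 1 ≠ 0 := sub_ne_zero.mpr hs1
  -- the residue `C(1) R` is the proposed `ρ`
  have hmult : rayMult h𝔟 hcop N = h₀ := rayMult_eq_natCard h𝔟 hcop N
  have hh0 : (h₀ : ℂ) ≠ 0 := by
    rw [← hmult]; exact_mod_cast rayMult_ne_zero h𝔟 hcop hN0 hN hNm
  have hN𝔪 : ((Ideal.absNorm 𝔪 : ℕ) : ℂ) ≠ 0 := by
    have : (0 : ℝ) < Ideal.absNorm 𝔪 := by
      exact_mod_cast Nat.pos_of_ne_zero (by rwa [ne_eq, Ideal.absNorm_eq_zero_iff])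
    exact_mod_cast this.ne'
  have hd : ((Real.sqrt |(discr K : ℝ)| : ℝ) : ℂ) ≠ 0 := by
    exact_mod_cast (Real.sqrt_pos.mpr (abs_pos.mpr (Int.cast_ne_zero.mpr (discr_ne_zero K)))).ne'
  have hc0 : ((NumberField.pieceCst K N : ℝ) : ℂ) ≠ 0 :=
    Complex.ofReal_ne_zero.mpr (NumberField.pieceCst_pos hN0).ne'
  have hA0 : NumberField.gammaFactorCP K ∅ (1 / 2) ≠ 0 :=
    NumberField.gammaFactorCP_ne_zero ∅ (by norm_num [Complex.div_ofNat_re])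
  have hε : (NumberField.heckePairW K ∅ I 1 N).ε =
      ((((FractionalIdeal.absNorm (rayModulus K 𝔪 𝔟) : ℝ) * Real.sqrt |(discr K : ℝ)|)⁻¹ : ℝ) : ℂ) := by
    simp only [NumberField.heckePairW, Finset.card_empty, pow_zero, one_mul]
    rfl
  have hnorm : FractionalIdeal.absNorm (rayModulus K 𝔪 𝔟) =
      (Ideal.absNorm 𝔪 : ℚ) * ((Ideal.absNorm 𝔟 : ℚ))⁻¹ := by
    rw [rayModulus, map_mul, map_inv₀, FractionalIdeal.coeIdeal_absNorm, FractionalIdeal.coeIdeal_absNorm]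
  have hC1R : C 1 * R = ((h₀ : ℂ))⁻¹ * ((2 : ℂ) ^ Fintype.card {w : InfinitePlace K // IsReal w})⁻¹ *
      (2 * ((((Ideal.absNorm 𝔪 : ℝ) * Real.sqrt |(discr K : ℝ)|)⁻¹ : ℝ) : ℂ) *
        ((((NumberField.pieceCst K N : ℝ) : ℂ))⁻¹ * (NumberField.gammaFactorCP K ∅ (1 / 2))⁻¹)) := by
    rw [hC, hR]
    dsimp only
    rw [Complex.cpow_neg_one, hmult, hε, hnorm]
    push_cast
    field_simp
  -- assemble
  have hsum : ∑ p : Finset {w : InfinitePlace K // IsReal w},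
      (NumberField.pieceDirichlet K p 1 (rayModulus K 𝔪 𝔟) 1 N s -
        NumberField.pieceDirichlet K p (-1) (rayModulus K 𝔪 𝔟) 1 N s) =
      ∑ p : Finset {w : InfinitePlace K // IsReal w},
        NumberField.signedCosetSum K p (I : FractionalIdeal (𝓞 K)⁰ K) 1 N s :=
    rfl
  have hCs : C s = ((rayMult h𝔟 hcop N : ℂ))⁻¹ *
    ((2 : ℂ) ^ Fintype.card {w : InfinitePlace K // IsReal w})⁻¹ * ((Ideal.absNorm 𝔟 : ℕ) : ℂ) ^ (-s) := rfl
  rw [rayClassPartialZeta_eq_sum_pieceDirichlet h𝔟 hcop hN0 hN hNm hs, hsum, hEs s hs, ← hCs, ← hC1R]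
  dsimp only
  rw [dslope_of_ne _ hs1, slope_def_field]
  field_simp
  ring

/-! ### Hecke's theorem with growth: `L(χ, s)` is entire of finite order for `χ ≠ 1` -/

/-- **The L-series of a non-principal ray class character is entire of finite order** (Hecke 1917 / Neukirch
VII (8.5)–(8.6), §5 p. 473: "If `χ ≠ 1`, then `Z(χ, s)` is holomorphic on all of `ℂ`, as `Σ_𝔎 χ(𝔎) = 0`";
with the growth bound of the integral representation).  For `𝔪 ≠ 0` and a ray class character `χ mod 𝔪`
with `χ(𝔭) ≠ 1` for some prime `𝔭 ∤ 𝔪`, there is an entire `L` with `L(s) = L(χ, s)` for `Re(s) > 1` and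
`‖L(s)‖ ≤ A_R exp(c_R ‖s‖²)` on every vertical strip `|Re s| ≤ R`.
[cite: NeukirchANT1999, Ch. VII §8 Thm. (8.5), Cor. (8.6) and Remark 1; §5 p. 473]
[cite: Rademacher1959, §5] -/
theorem exists_differentiable_eq_rayClassLSeries_growth {𝔪 : Ideal (𝓞 K)} (h𝔪 : 𝔪 ≠ ⊥)
    {ψ : HeightOneSpectrum (𝓞 K) → ℂ} (hψ : IsRayClassCharacter 𝔪 ψ)
    (hnt : ∃ v : HeightOneSpectrum (𝓞 K), ¬ 𝔪 ≤ v.asIdeal ∧ ψ v ≠ 1) :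
    ∃ L : ℂ → ℂ, Differentiable ℂ L ∧
      (∀ R : ℝ, 0 ≤ R → ∃ A c : ℝ, 0 ≤ A ∧ 0 ≤ c ∧ ∀ s ∈ {s : ℂ | |s.re| ≤ R},
        ‖L s‖ ≤ A * Real.exp (c * ‖s‖ ^ 2)) ∧
      ∀ s : ℂ, 1 < s.re → L s = rayClassLSeries 𝔪 ψ s := by
  obtain ⟨ρ, hZ⟩ := exists_rayClassPartialZeta_eq_add_div_growth h𝔪
  obtain ⟨v, hv, hv1⟩ := hnt
  obtain ⟨T, hT⟩ := exists_isRayClassReps (K := K) h𝔪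
  choose Z₀ hZ₀ hZg hZs using
    fun 𝔟 : T => hZ 𝔟.1 (hT.ne_bot_and_isCoprime 𝔟.1 𝔟.2).1 (hT.ne_bot_and_isCoprime 𝔟.1 𝔟.2).2
  refine ⟨fun s => ∑ 𝔟 ∈ T.attach, idealPow K ψ 𝔟.1 * Z₀ 𝔟 s, ?_, fun R hR => ?_, fun s hs => ?_⟩
  · exact Differentiable.fun_sum fun 𝔟 _ => (hZ₀ 𝔟).const_mul _
  · exact NumberField.growth_sum T.attach (F := fun 𝔟 s ↦ idealPow K ψ 𝔟.1 * Z₀ 𝔟 s) fun 𝔟 _ =>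
      NumberField.growth_of_le (fun s _ => le_of_eq (by rw [Pi.mul_apply]))
        (NumberField.growth_mul (NumberField.growth_const {s : ℂ | |s.re| ≤ R} (idealPow K ψ 𝔟.1)) (hZg 𝔟 R hR))
  · have horth : ∑ 𝔟 ∈ T.attach, idealPow K ψ 𝔟.1 = 0 := by
      rw [Finset.sum_attach T (fun 𝔟 => idealPow K ψ 𝔟)]
      exact hT.sum_idealPow_eq_zero h𝔪 hψ hv hv1
    dsimp only
    rw [rayClassLSeries_eq_sum_rayClassPartialZeta h𝔪 hψ hT hs, ← Finset.sum_attach T]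
    symm
    calc ∑ 𝔟 ∈ T.attach, idealPow K ψ 𝔟.1 * rayClassPartialZeta 𝔪 𝔟.1 s
        = ∑ 𝔟 ∈ T.attach, (idealPow K ψ 𝔟.1 * Z₀ 𝔟 s + idealPow K ψ 𝔟.1 * (ρ / (s - 1))) :=
          Finset.sum_congr rfl fun 𝔟 _ => by rw [hZs 𝔟 s hs, mul_add]
      _ = ∑ 𝔟 ∈ T.attach, idealPow K ψ 𝔟.1 * Z₀ 𝔟 s +
            (∑ 𝔟 ∈ T.attach, idealPow K ψ 𝔟.1) * (ρ / (s - 1)) := by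
          rw [Finset.sum_add_distrib, Finset.sum_mul]
      _ = ∑ 𝔟 ∈ T.attach, idealPow K ψ 𝔟.1 * Z₀ 𝔟 s := by rw [horth, zero_mul, add_zero]

/-- **Finite order in the classical shape**: the continuation satisfies `‖L(s)‖ ≤ A exp(‖s‖³ )`-type bounds;
precisely, for every `R ≥ 0` there is `C` with `‖L(s)‖ ≤ C exp(|Im s|^3)` on the strip `|Re s| ≤ R` (the
hypothesis shape of the tree's Phragmén–Lindelöf theorem `rademacher_phragmenLindelof_of_finiteOrder`).
[cite: Rademacher1959, §5] -/
theorem exists_differentiable_eq_rayClassLSeries_finiteOrder {𝔪 : Ideal (𝓞 K)} (h𝔪 : 𝔪 ≠ ⊥)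
    {ψ : HeightOneSpectrum (𝓞 K) → ℂ} (hψ : IsRayClassCharacter 𝔪 ψ)
    (hnt : ∃ v : HeightOneSpectrum (𝓞 K), ¬ 𝔪 ≤ v.asIdeal ∧ ψ v ≠ 1) :
    ∃ L : ℂ → ℂ, Differentiable ℂ L ∧
      (∀ R : ℝ, 0 ≤ R → ∃ C : ℝ, 0 ≤ C ∧ ∀ s : ℂ, |s.re| ≤ R → ‖L s‖ ≤ C * Real.exp (|s.im| ^ (3 : ℝ))) ∧
      ∀ s : ℂ, 1 < s.re → L s = rayClassLSeries 𝔪 ψ s := by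
  obtain ⟨L, hLd, hLg, hLs⟩ := exists_differentiable_eq_rayClassLSeries_growth h𝔪 hψ hnt
  refine ⟨L, hLd, fun R hR => ?_, hLs⟩
  obtain ⟨A, c, hA, hc, h⟩ := hLg R hR
  -- `c ‖s‖² ≤ c R² + c t² ≤ c R² + t³ + c³` (`c t² ≤ t³ + c³`)
  refine ⟨A * Real.exp (c * R ^ 2 + c ^ 3), by positivity, fun s hs => ?_⟩
  have h1 := h s hs
  have hns : ‖s‖ ^ 2 = s.re ^ 2 + s.im ^ 2 := by
    rw [← Complex.normSq_eq_norm_sq, Complex.normSq_apply]; ring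
  have hre2 : s.re ^ 2 ≤ R ^ 2 := by
    have h2 : |s.re| ^ 2 ≤ R ^ 2 := pow_le_pow_left₀ (abs_nonneg _) hs 2
    rwa [sq_abs] at h2
  have ht : c * s.im ^ 2 ≤ |s.im| ^ (3 : ℝ) + c ^ 3 := by
    have h3 : |s.im| ^ (3 : ℝ) = |s.im| ^ (3 : ℕ) := by
      rw [show (3 : ℝ) = ((3 : ℕ) : ℝ) by norm_num, Real.rpow_natCast]
    rw [h3, ← sq_abs s.im]
    exact NumberField.mul_sq_le_cube_add hc (abs_nonneg _)
  have hexp : Real.exp (c * ‖s‖ ^ 2) ≤ Real.exp (c * R ^ 2 + c ^ 3) * Real.exp (|s.im| ^ (3 : ℝ)) := by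
    rw [← Real.exp_add]
    refine Real.exp_le_exp.mpr ?_
    rw [hns, mul_add]
    nlinarith [mul_le_mul_of_nonneg_left hre2 hc]
  calc ‖L s‖ ≤ A * Real.exp (c * ‖s‖ ^ 2) := h1
    _ ≤ A * (Real.exp (c * R ^ 2 + c ^ 3) * Real.exp (|s.im| ^ (3 : ℝ))) :=
        mul_le_mul_of_nonneg_left hexp hA
    _ = A * Real.exp (c * R ^ 2 + c ^ 3) * Real.exp (|s.im| ^ (3 : ℝ)) := by ring

end Literature.NumberTheory.LFunctions
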